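import Mathlib
import Literature.Combinatorics.Optimization.CorrelationPolytopeGridMinor
import Literature.Combinatorics.Optimization.CorrelationPolytopeMinorMonotone
import Literature.Combinatorics.Optimization.CorrelationPolytopeFaces
import Literature.Combinatorics.Optimization.CorrelationFaceGates
import Literature.Combinatorics.Optimization.GridCoordinates
import Literature.Combinatorics.Optimization.GridCorCrossoverBlock
import Literature.Combinatorics.Optimization.GridCorTiling
import Literature.Barriers.PneNP.TSPExtensionComplexityFaces
import Literature.Barriers.PneNP.ExtendedFormulationLinearImage
import Literature.Barriers.PneNP.CorrelationPolytopeXCLowerBoundGraph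
import HarnessLib

/-!
# A face of `COR(G_{t,t})` projects onto `COR(K_{⌊t/16⌋})` (Aboulker et al. 2019, Thm. 6 core);
# `xc(COR(G_{t,t})) ≥ 2^{Ω(t)}`; discharge of `AboulkerEtAl2019_corGridMinor`

P. Aboulker, S. Fiorini, T. Huynh, M. Macchia, J. Seif, *Extension complexity of the correlation
polytope*, Oper. Res. Lett. 47 (2019) = arXiv:1806.00541, Theorem 6: "For every proper minor-closed class
`𝒞`, there exists a constant `c' > 0` such that for every `n`-vertex graph `G ∈ 𝒞`,
`xc(COR(G)) ≥ 2^{c' tw(G)}`", with the remark after Theorem 3: "the proof of Theorem 6 shows that for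
every graph `G`, we have `xc(COR(G)) ≥ 2^{Ω(h + log n)}`, where `h` is the maximum height of a grid that
`G` contains as a minor."  The printed proof (p. 5 L49 – p. 6 L22): a grid with gadgets `H` of height
`h = Ω(t)` is a minor of `G_{t,t}` (Obs. 5: `xc(COR(·))` is minor-monotone); "a face of `COR(H)` …
projects to the correlation polytope of the complete bipartite graph `K_{h,h}`" (wire equations
`x_i = x_j = x_{ij}` propagate the left / bottom values, Lichtenstein-type crossover gadgets keep rows and
columns independent, every equation "originate[s] from valid inequalities"); "`K_h` is a minor of
`K_{h,h}`"; and "[KW15] … `xc(COR(K_h)) ≥ (1.5)^h`".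

This file assembles the tree's version of that argument:

* `AboulkerEtAl2019_gridCorCliqueFace` — THE CONSTRUCTION (the exact text of the `ValiantsHypothesis`
  support item `GridCorCliqueFace`): there are `c > 0` (`= 1/32`) and `t₀` (`= 32`) such that for every
  `t ≥ t₀` some `h ≥ c·t` (`= ⌊t/16⌋`), finitely many inequalities `cv_i · x ≤ δ_i` VALID on
  `COR(G_{t,t})` and a linear map `π` satisfy `π(COR(G_{t,t}) ∩ {cv_i · x = δ_i ∀ i}) = COR(K_h)`.
  SAME STATEMENT as the printed step, NOT the printed route: one face of `COR(G_{t,t})` written in place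
  (no intermediate graph `H`, no minor embedding, so the printed "observe that there exists `h = Ω(t)`
  such that … `H ≼ G_{t,t}`" is avoided rather than proved), crossover = three XOR gates of four NAND
  gates each, every NAND gate ONE valid inequality on a grid `4`-cycle (`GridCorCrossoverBlock.lean`,
  `CorrelationFaceGates.lean`), column wire `i` fed from row wire `i` at the diagonal block (instead of the
  `K_{h,h}` layout plus the identification `x_{ℓ_i} = x_{ℓ_i b_i} = x_{b_i}` of `K_h ≼ K_{h,h}`), tiling and
  propagation `GridCorTiling.formA_of_blocks`, faces `CorrelationPolytopeFaces.lean`.  The constants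
  `1/32`, `32`, `16` are this construction's; print gives none.
* `AboulkerEtAl2019_corGridBound`, `AboulkerEtAl2019_corGridBound_eventually` — the pure grid bound
  "`xc(COR(G_{h,h})) ≥ 2^{c h}` for `h ≥ h₀`" (`c = 1/64`, `h₀ = 128`): faces and linear images keep the
  size of an extended formulation (`HasEFOfSize.inter_eqs`, `HasEFOfSize.image_linearMap`) and
  `xc(COR(K_m)) ≥ 2^{m/2}` (Kaibel–Weltge, `corPolytopeGraph_top_two_pow_half_le`).
* `AboulkerEtAl2019_corGridMinor_holds : AboulkerEtAl2019_corGridMinor` — DISCHARGE of the named fact of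
  `CorrelationPolytopeGridMinor.lean` (grid minors force `xc(COR(G)) ≥ 2^{ch}`), by Observation 5
  (`AboulkerEtAl2019_corGridMinor_iff_grid`, `CorrelationPolytopeMinorMonotone.lean`).

No new definition of mathematical content (the `def`s below are the placed row families handed to
`formA_of_blocks`); no named fact.

## References

* P. Aboulker, S. Fiorini, T. Huynh, M. Macchia, J. Seif, *Extension complexity of the correlation
  polytope*, Oper. Res. Lett. 47 (2019) 47–51, doi:10.1016/j.orl.2018.12.001 = arXiv:1806.00541: Obs. 5
  (p. 5 L12–18), §2 grid with gadgets (p. 5 L21–33), Thm. 6 and its proof (p. 5 L41 – p. 6 L22), remark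
  after Thm. 3 (p. 4 L1).  Bib key `AboulkerEtAl2019`.
* V. Kaibel, S. Weltge, *A short proof that the extension complexity of the correlation polytope grows
  exponentially*, DCG 53 (2015) = arXiv:1307.3543, Thm. 1 (`xc(COR(K_h)) ≥ 1.5^h`).  Bib key
  `KaibelWeltge2014`.
-/

noncomputable section

namespace Literature.Combinatorics.Optimization

namespace GridCorCliqueFaceProof

open Matrix Finset
open Literature.Barriers.PneNP (HasEFOfSize)
open Literature.Computability.MetaComplexity (gridGraph gridAdj)
open GridCorBlock GridCorTiling

/-- The canonical placement of the `16 × 16` block `(i,j)` in `G_{t,t}`: cell `(r,c)` ↦ row `16i + r`,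
column `16j + c`, i.e. the vertex `(16i + r)·t + (16j + c)`. [cite: AboulkerEtAl2019, §2 (p. 5 L21–33: the grid with gadgets lives in the grid)] -/
def blockMap (t i j : ℕ) (hi : 16 * i + 16 ≤ t) (hj : 16 * j + 16 ≤ t) (p : Cell) : Fin (t * t) :=
  ⟨(16 * i + p.1) * t + (16 * j + p.2),
    (vtx_spec (t := t) (r := 16 * i + p.1) (c := 16 * j + p.2)
      (by have := p.1.isLt; omega) (by have := p.2.isLt; omega)).1⟩

/-- Value of the canonical placement (plumbing). [folklore] -/
private theorem blockMap_val (t i j : ℕ) (hi : 16 * i + 16 ≤ t) (hj : 16 * j + 16 ≤ t) (p : Cell) :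
    (blockMap t i j hi hj p : ℕ) = (16 * i + p.1) * t + (16 * j + p.2) := rfl

/-- A value-level block map IS the canonical placement (plumbing). [folklore] -/
private theorem eq_blockMap {t i j : ℕ} (hi : 16 * i + 16 ≤ t) (hj : 16 * j + 16 ≤ t)
    (ι : Cell → Fin (t * t)) (hι : ∀ p, (ι p : ℕ) = (16 * i + p.1) * t + (16 * j + p.2)) :
    ι = blockMap t i j hi hj := by
  funext p; exact Fin.ext (hι p)

/-- Local adjacency (`.val` form of `GridCorCrossoverBlock`) in the `Fin`-equality form of
`GridCorTiling.block_adj` (plumbing). [folklore] -/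
private theorem localAdj_fin {p q : Cell} (h : LocalAdj p q) :
    (p.1 = q.1 ∧ ((p.2 : ℕ) + 1 = q.2 ∨ (q.2 : ℕ) + 1 = p.2)) ∨
      (p.2 = q.2 ∧ ((p.1 : ℕ) + 1 = q.1 ∨ (q.1 : ℕ) + 1 = p.1)) := by
  rcases h with ⟨h1, h2⟩ | ⟨h1, h2⟩
  · exact Or.inl ⟨Fin.ext h1, h2⟩
  · exact Or.inr ⟨Fin.ext h1, h2⟩

/-- All constrained pairs of a placed crossover block are edges of `G_{t,t}`. [cite: AboulkerEtAl2019, proof of Thm. 6 (p. 5 L51–60: gadgets placed in the grid)] -/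
theorem cross_hadj {t i j : ℕ} (hj : 16 * j + 16 ≤ t) (ι : Cell → Fin (t * t))
    (hι : ∀ p, (ι p : ℕ) = (16 * i + p.1) * t + (16 * j + p.2)) :
    ∀ e ∈ crossEdges, (gridGraph t).Adj (ι e.1) (ι e.2) := fun e he =>
  block_adj (K := 16) i j hj ι hι (localAdj_fin (crossEdges_localAdj e he))

/-- All constrained pairs of a placed junction block are edges of `G_{t,t}`. [cite: AboulkerEtAl2019, proof of Thm. 6 (p. 5 L51–60)] -/
theorem junc_hadj {t i j : ℕ} (hj : 16 * j + 16 ≤ t) (ι : Cell → Fin (t * t))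
    (hι : ∀ p, (ι p : ℕ) = (16 * i + p.1) * t + (16 * j + p.2)) :
    ∀ e ∈ juncEdges, (gridGraph t).Adj (ι e.1) (ι e.2) := fun e he =>
  block_adj (K := 16) i j hj ι hι (localAdj_fin (juncEdges_localAdj e he))

/-- Number of rows of a crossover block. [folklore] -/
abbrev nX : ℕ := Fintype.card CrossIx

/-- Number of rows of a junction block. [folklore] -/
abbrev nJ : ℕ := Fintype.card JuncIx

/-- The rows of the crossover block `(i,j)` of `G_{t,t}` (zero if the block does not fit).
[cite: AboulkerEtAl2019, proof of Thm. 6 (p. 5 L53 – p. 6 L19)] -/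
def rowsX (t i j : ℕ) (r : Fin nX) : Fin (t * t) × Fin (t * t) → ℝ :=
  if h : 16 * i + 16 ≤ t ∧ 16 * j + 16 ≤ t then
    crossCv (blockMap t i j h.1 h.2) ((Fintype.equivFin CrossIx).symm r)
  else 0

/-- Right-hand sides of the crossover rows. [cite: AboulkerEtAl2019, proof of Thm. 6 (p. 6 L3)] -/
def rhsX (r : Fin nX) : ℝ := crossRhs ((Fintype.equivFin CrossIx).symm r)

/-- The rows of the junction block `(i,i)` of `G_{t,t}` (zero if it does not fit).
[cite: AboulkerEtAl2019, proof of Thm. 6 (p. 6 L17)] -/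
def rowsJ (t i : ℕ) (r : Fin nJ) : Fin (t * t) × Fin (t * t) → ℝ :=
  if h : 16 * i + 16 ≤ t then
    juncCv (blockMap t i i h h) ((Fintype.equivFin JuncIx).symm r)
  else 0

/-- Right-hand sides of the junction rows. [cite: AboulkerEtAl2019, proof of Thm. 6 (p. 6 L17)] -/
def rhsJ (r : Fin nJ) : ℝ := juncRhs ((Fintype.equivFin JuncIx).symm r)

/-- (V) for the placed crossover rows. [cite: AboulkerEtAl2019, proof of Thm. 6 (p. 6 L3)] -/
theorem rowsX_valid (t i j : ℕ) (hi : 16 * i + 16 ≤ t) (hj : 16 * j + 16 ≤ t) (r : Fin nX)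
    (b : Fin (t * t) → Bool) : rowsX t i j r ⬝ᵥ corVec (gridGraph t) b ≤ rhsX r := by
  simp only [rowsX, rhsX, dif_pos (And.intro hi hj)]
  exact cross_valid (cross_hadj hj _ (blockMap_val t i j hi hj)) _ b

/-- (V) for the placed junction rows. [cite: AboulkerEtAl2019, proof of Thm. 6 (p. 6 L17)] -/
theorem rowsJ_valid (t i : ℕ) (hi : 16 * i + 16 ≤ t) (r : Fin nJ) (b : Fin (t * t) → Bool) :
    rowsJ t i r ⬝ᵥ corVec (gridGraph t) b ≤ rhsJ r := by
  simp only [rowsJ, rhsJ, dif_pos hi]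
  exact junc_valid (junc_hadj hi _ (blockMap_val t i i hi hi)) _ b

/-- (D) for the placed crossover block. [cite: AboulkerEtAl2019, proof of Thm. 6 (p. 5 L58–60)] -/
theorem rowsX_desc (t i j : ℕ) (ι : Cell → Fin (t * t))
    (hι : ∀ p, (ι p : ℕ) = (16 * i + p.1) * t + (16 * j + p.2)) (hi : 16 * i + 16 ≤ t)
    (hj : 16 * j + 16 ≤ t) (b : Fin (t * t) → Bool)
    (ht : ∀ r, rowsX t i j r ⬝ᵥ corVec (gridGraph t) b = rhsX r) :
    b (ι right) = b (ι left) ∧ b (ι top) = b (ι bot) ∧ b (ι rdA) = b (ι left) ∧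
      b (ι rdB) = b (ι bot) := by
  have hιe := eq_blockMap hi hj ι hι
  refine cross_desc (G := gridGraph t) (cross_hadj hj ι hι) b fun r => ?_
  have := ht (Fintype.equivFin CrossIx r)
  simp only [rowsX, rhsX, dif_pos (And.intro hi hj), Equiv.symm_apply_apply] at this
  rwa [← hιe] at this

/-- (L) for the placed crossover block. [cite: AboulkerEtAl2019, proof of Thm. 6 (p. 6 L14–19)] -/
theorem rowsX_lift (t i j : ℕ) (ι : Cell → Fin (t * t))
    (hι : ∀ p, (ι p : ℕ) = (16 * i + p.1) * t + (16 * j + p.2)) (hi : 16 * i + 16 ≤ t)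
    (hj : 16 * j + 16 ≤ t) (A B : Bool) (b : Fin (t * t) → Bool)
    (hb : ∀ p, b (ι p) = crossVal p A B) (r : Fin nX) :
    rowsX t i j r ⬝ᵥ corVec (gridGraph t) b = rhsX r := by
  have hιe := eq_blockMap hi hj ι hι
  simp only [rowsX, rhsX, dif_pos (And.intro hi hj), ← hιe]
  exact cross_lift (G := gridGraph t) (cross_hadj hj ι hι) A B b hb _

/-- (D) for the placed junction block. [cite: AboulkerEtAl2019, proof of Thm. 6 (p. 6 L17–19)] -/
theorem rowsJ_desc (t i : ℕ) (ι : Cell → Fin (t * t))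
    (hι : ∀ p, (ι p : ℕ) = (16 * i + p.1) * t + (16 * i + p.2)) (hi : 16 * i + 16 ≤ t)
    (b : Fin (t * t) → Bool) (ht : ∀ r, rowsJ t i r ⬝ᵥ corVec (gridGraph t) b = rhsJ r) :
    b (ι right) = b (ι left) ∧ b (ι top) = b (ι left) ∧ b (ι bot) = b (ι left) := by
  have hιe := eq_blockMap hi hi ι hι
  refine junc_desc (G := gridGraph t) (junc_hadj hi ι hι) b fun r => ?_
  have := ht (Fintype.equivFin JuncIx r)
  simp only [rowsJ, rhsJ, dif_pos hi, Equiv.symm_apply_apply] at this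
  rwa [← hιe] at this

/-- (L) for the placed junction block. [cite: AboulkerEtAl2019, proof of Thm. 6 (p. 6 L17–19)] -/
theorem rowsJ_lift (t i : ℕ) (ι : Cell → Fin (t * t))
    (hι : ∀ p, (ι p : ℕ) = (16 * i + p.1) * t + (16 * i + p.2)) (hi : 16 * i + 16 ≤ t)
    (A : Bool) (b : Fin (t * t) → Bool) (hb : ∀ p, b (ι p) = juncVal p A) (r : Fin nJ) :
    rowsJ t i r ⬝ᵥ corVec (gridGraph t) b = rhsJ r := by
  have hιe := eq_blockMap hi hi ι hι
  simp only [rowsJ, rhsJ, dif_pos hi, ← hιe]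
  exact junc_lift (G := gridGraph t) (junc_hadj hi ι hι) A b hb _

end GridCorCliqueFaceProof

open Matrix Finset
open Literature.Barriers.PneNP (HasEFOfSize)
open Literature.Computability.MetaComplexity (gridGraph)
open GridCorBlock GridCorTiling GridCorCliqueFaceProof

/-- **Aboulker–Fiorini–Huynh–Macchia–Seif 2019, the core of the proof of Theorem 6: a face of
`COR(G_{t,t})` projects onto `COR(K_h)` with `h = Ω(t)`** — here with `h = ⌊t/16⌋`, `c = 1/32`,
`t₀ = 32` (constants of THIS construction; print gives none).  STATEMENT = the printed step "a face of
`COR(H)` … projects to `COR(K_{h,h})`", `H ≼ G_{t,t}` a grid with gadgets of height `h = Ω(t)`, followed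
by "`K_h` is a minor of `K_{h,h}`" (a projection of a face of a projection of a face is a projection of a
face).  PROOF = this tree's construction, NOT the printed route: no intermediate graph `H` and no minor
embedding; one face of `COR(G_{t,t})` cut by WIRE rows `x_u = x_{uv} = x_v` (as printed) and by NAND-gate
rows on grid `4`-cycles (three XOR gates per crossing in place of the Lichtenstein-derived gadget of
Fig. 4(b)), column wire `i` fed from row wire `i` at the diagonal block (in place of the `K_{h,h}`
layout plus the identification `x_{ℓ_i} = x_{ℓ_i b_i} = x_{b_i}`), and the coordinate projection reading
the terminals and one unconstrained grid edge per off-diagonal block; blocks of pitch `16`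
(`GridCorCrossoverBlock.lean`), tiling and propagation (`GridCorTiling.lean`), faces
(`CorrelationPolytopeFaces.lean`, `CorrelationFaceGates.lean`).
[cite: AboulkerEtAl2019, Thm. 6 with its proof (arXiv:1806.00541 p. 5 L49 – p. 6 L22) and the remark after Thm. 3 (p. 4 L1) — statement; proof: this file's gate construction, not the printed gadget] -/
theorem AboulkerEtAl2019_gridCorCliqueFace :
    ∃ c : ℝ, 0 < c ∧ ∃ t₀ : ℕ, ∀ t : ℕ, t₀ ≤ t → ∃ h : ℕ, c * t ≤ h ∧
      ∃ (k : ℕ) (cv : Fin k → (Fin (t * t) × Fin (t * t) → ℝ)) (δ : Fin k → ℝ)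
        (π : (Fin (t * t) × Fin (t * t) → ℝ) →ₗ[ℝ] (Fin h × Fin h → ℝ)),
        (∀ i, ∀ x ∈ corPolytopeGraph (gridGraph t), cv i ⬝ᵥ x ≤ δ i) ∧
          π '' (corPolytopeGraph (gridGraph t) ∩ {x | ∀ i, cv i ⬝ᵥ x = δ i}) =
            corPolytopeGraph (⊤ : SimpleGraph (Fin h)) :=
  formA_of_blocks (K := 16) (by norm_num) rowsX rhsX rowsJ rhsJ crossVal juncVal
    left right top bot rdA rdB rfl rfl rfl rfl rfl rfl (Or.inr ⟨rfl, Or.inl rfl⟩)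
    (fun A B => let h := crossVal_ports A B; ⟨h.1, h.2.1, h.2.2.1, h.2.2.2.1⟩) juncVal_ports
    (fun t i j hi hj r b => rowsX_valid t i j hi hj r b)
    (fun t i j ι hι hi hj b ht => rowsX_desc t i j ι hι hi hj b ht)
    (fun t i j ι hι hi hj A B b hb r => rowsX_lift t i j ι hι hi hj A B b hb r)
    (fun t i hi r b => rowsJ_valid t i hi r b)
    (fun t i ι hι hi b ht => rowsJ_desc t i ι hι hi b ht)
    (fun t i ι hι hi A b hb r => rowsJ_lift t i ι hι hi A b hb r)

/-- **The pure grid bound: `xc(COR(G_{t,t})) ≥ 2^{t/64}` for `t ≥ 128`** (threshold form: there are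
`c > 0`, `h₀` with `2^{c·h} ≤ R` for every extended formulation of size `R` of `COR(G_{h,h})`, `h ≥ h₀`):
the face of `AboulkerEtAl2019_gridCorCliqueFace` keeps the size (`HasEFOfSize.inter_eqs`), so does its
linear image (`HasEFOfSize.image_linearMap`), and `xc(COR(K_m)) ≥ 2^{m/2}` for `m ≥ 4` (Kaibel–Weltge,
`corPolytopeGraph_top_two_pow_half_le`). [cite: AboulkerEtAl2019, Thm. 6 (p. 5 L41–46) with the remark after Thm. 3 (p. 4 L1: "xc(COR(G)) ≥ 2^{Ω(h + log n)}, where h is the maximum height of a grid that G contains as a minor") and p. 6 L21–22 ("In [KW15], it is shown that xc(COR(K_h)) ≥ (1.5)^h")] -/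
theorem AboulkerEtAl2019_corGridBound :
    ∃ c : ℝ, 0 < c ∧ ∃ h₀ : ℕ, ∀ h : ℕ, h₀ ≤ h →
      ∀ R : ℕ, HasEFOfSize (corPolytopeGraph (gridGraph h)) R → (2 : ℝ) ^ (c * h) ≤ R := by
  obtain ⟨c, hc, t₀, hface⟩ := AboulkerEtAl2019_gridCorCliqueFace
  refine ⟨c / 2, by positivity, max t₀ (Nat.ceil (4 / c)), fun t ht R hR => ?_⟩
  have ht₀ : t₀ ≤ t := le_trans (le_max_left _ _) ht
  have htc : (Nat.ceil (4 / c) : ℝ) ≤ t := by exact_mod_cast le_trans (le_max_right _ _) ht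
  obtain ⟨m, hm, k, cv, δ, π, _hvalid, himage⟩ := hface t ht₀
  -- the face and its image keep the size
  have hF : HasEFOfSize (corPolytopeGraph (gridGraph t) ∩ {x | ∀ i, cv i ⬝ᵥ x = δ i}) R :=
    hR.inter_eqs cv δ
  have hK : HasEFOfSize (corPolytopeGraph (⊤ : SimpleGraph (Fin m))) R := by
    rw [← himage]; exact hF.image_linearMap π
  -- `m ≥ 4`
  have h4c : 4 / c ≤ t := le_trans (Nat.le_ceil _) htc
  have hm4r : (4 : ℝ) ≤ m := by
    have : 4 ≤ c * t := by
      have := mul_le_mul_of_nonneg_left h4c hc.le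
      rwa [mul_div_cancel₀ _ hc.ne'] at this
    linarith
  have hm4 : 4 ≤ m := by exact_mod_cast hm4r
  have hbound := Literature.Barriers.PneNP.corPolytopeGraph_top_two_pow_half_le hm4 hK
  -- `2^{(c/2) t} ≤ 2^{m/2} ≤ R`
  have hexp : c / 2 * (t : ℝ) ≤ (m : ℝ) / 2 := by linarith
  calc (2 : ℝ) ^ (c / 2 * (t : ℝ)) ≤ (2 : ℝ) ^ ((m : ℝ) / 2) :=
        Real.rpow_le_rpow_of_exponent_le (by norm_num) hexp
    _ ≤ R := hbound

/-- The same bound in the `∀ᶠ` shape of the `ValiantsHypothesis` consumers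
(`QueueGridFace.nfPolytopeQuasiPolyXC_of_corGridBound`). [cite: AboulkerEtAl2019, Thm. 6 and the remark after Thm. 3 (p. 4 L1)] -/
theorem AboulkerEtAl2019_corGridBound_eventually :
    ∃ c : ℝ, 0 < c ∧ ∀ᶠ t : ℕ in Filter.atTop,
      ∀ R : ℕ, HasEFOfSize (corPolytopeGraph (gridGraph t)) R → (2 : ℝ) ^ (c * t) ≤ R := by
  obtain ⟨c, hc, h₀, h⟩ := AboulkerEtAl2019_corGridBound
  exact ⟨c, hc, Filter.eventually_atTop.2 ⟨h₀, h⟩⟩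

/-- **Discharge of the named fact `AboulkerEtAl2019_corGridMinor`** (`CorrelationPolytopeGridMinor.lean`:
every graph with an `h × h` grid minor, `h ≥ h₀`, has `xc(COR(G)) ≥ 2^{ch}`): by Observation 5
(`AboulkerEtAl2019_corGridMinor_iff_grid`, proved in `CorrelationPolytopeMinorMonotone.lean`) it is
equivalent to the pure grid bound `AboulkerEtAl2019_corGridBound`.
[cite: AboulkerEtAl2019, Thm. 6 with the remark after Thm. 3 (arXiv:1806.00541 p. 4 L1) and Obs. 5 (p. 5 L12–13)] -/
theorem AboulkerEtAl2019_corGridMinor_holds : AboulkerEtAl2019_corGridMinor :=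
  AboulkerEtAl2019_corGridMinor_iff_grid.2 AboulkerEtAl2019_corGridBound

end Literature.Combinatorics.Optimization

end
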